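import Mathlib
import Summits.NavierStokesRegularity.NavierStokesRegularity.Theorems.EulerZoomLiouvillePowerGaugeEulerLiouvilleSelfSimilarEndpointPressureTools
import HarnessLib

/-!
# Rung C1 of the crux `EulerZoomLiouville.PowerGaugeEulerLiouville` at the endpoint `ρ = 1/2`:
# the mid-source pressure on a dyadic shell (Chae–Shvydkoy 2013, proof of Thm 3.1, term q₂)

Route №10 `EulerZoomLiouville` (NavierStokesRegularity), crux E = stmt-NavierStokesRegularity-19832,
tenure rung C1 at the endpoint.  For a profile `V ∈ L² ∩ L³_loc` with the sublinear growth
`‖V(y)‖ ≤ C_up |y|^{1−δ}` (`|y| ≥ R₀`) and a pressure `P` which, below `|y| < 16L`, is the Riesz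
pressure of `V·1_{B_{32L}}` plus the honest kernel integral of the sources `|z| ≥ 32L`, we bound
the flux integrand of the shell `S_L = {L/4 ≤ |y| ≤ 8L}` as in Chae–Shvydkoy's proof of Thm 3.1
(arXiv:1201.6009, §3.1), but keeping the far-field terms SUBLINEAR (no lower bound on `V` used):

* helpers: `V·1_s ∈ L³` / `∈ Lᵖ` for bounded `s` (`memLp_indicator_three_of_subset`,
  `memLp_indicator_of_bound`), Cauchy–Schwarz on a set (`setIntegral_abs_mul_norm_le_sqrt`), and
  the passage from Stein's bound in `eLpNorm` form to real integrals
  (`sqrt_integral_sq_le_of_eLpNorm_le`);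
* `setIntegral_abs_rieszPressure_mul_norm_le` — mid sources (Calderón–Zygmund in `L²`):
  `∫_S |Π[V·1_T]| ‖V‖ ≤ C_S · M · ∫_T ‖V‖²` whenever `‖V‖ ≤ M` a.e. on the bounded set `T ⊇ S`.
The near/far sources and the assembled shell estimate are in the sequel `…EndpointPressure`.

WHAT THIS IS NOT: not NS, not E, not rung C1 — the analytic input of one endpoint stratum.
-/

noncomputable section

-- flat `Theorems/<Route><Decl>…` files of one crux share the namespace of the crux (tree convention)
set_option linter.dupNamespace false

open MeasureTheory Set Filter Topology Metric Function
open scoped ENNReal NNReal InnerProductSpace RealInnerProductSpace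

namespace Summit.NavierStokesRegularity.NavierStokesRegularity.Theorems.PowerGaugeEulerLiouville

open Literature.Analysis Literature.Analysis.FluidPDE

section Helpers

variable {V : EuclideanSpace ℝ (Fin 3) → EuclideanSpace ℝ (Fin 3)}

/-- `V·1_s ∈ L³` for a bounded measurable `s` when `‖V‖³ ∈ L¹_loc`. [folklore] -/
theorem memLp_indicator_three_of_subset (hVm : AEStronglyMeasurable V volume)
    (hV3 : LocallyIntegrable (fun y => ‖V y‖ ^ 3) volume) {s : Set (EuclideanSpace ℝ (Fin 3))}
    (hs : MeasurableSet s) {R : ℝ} (hsR : s ⊆ closedBall (0 : EuclideanSpace ℝ (Fin 3)) R) :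
    MemLp (s.indicator V) 3 volume := by
  rw [memLp_indicator_iff_restrict hs,
    ← integrable_norm_rpow_iff hVm.restrict (by norm_num) (by norm_num)]
  have h : IntegrableOn (fun y => ‖V y‖ ^ 3) s volume :=
    (hV3.integrableOn_isCompact (isCompact_closedBall 0 R)).mono_set hsR
  refine h.congr_fun (fun y _ => ?_) hs
  rw [ENNReal.toReal_ofNat]
  norm_cast

/-- `V·1_s ∈ Lᵖ` for every `p` when `‖V‖ ≤ M` a.e. on the finite-measure set `s`. [folklore] -/
theorem memLp_indicator_of_bound (hVm : AEStronglyMeasurable V volume)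
    {s : Set (EuclideanSpace ℝ (Fin 3))} (hs : MeasurableSet s) (hμs : volume s ≠ ⊤) {M : ℝ}
    (hM : ∀ᵐ y ∂volume, y ∈ s → ‖V y‖ ≤ M) (p : ℝ≥0∞) : MemLp (s.indicator V) p volume := by
  rw [memLp_indicator_iff_restrict hs]
  haveI := isFiniteMeasure_restrict.2 hμs
  exact MemLp.of_bound hVm.restrict M ((ae_restrict_iff' hs).2 hM)

/-- `‖V·1_s‖ⁿ = 1_s ‖V‖ⁿ` under the integral (`n ≥ 1`). [folklore] -/
theorem integral_norm_indicator_pow {s : Set (EuclideanSpace ℝ (Fin 3))} (hs : MeasurableSet s)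
    {n : ℕ} (hn : n ≠ 0) :
    ∫ y, ‖s.indicator V y‖ ^ n = ∫ y in s, ‖V y‖ ^ n := by
  rw [← integral_indicator hs]
  congr 1
  funext y
  by_cases hy : y ∈ s
  · rw [indicator_of_mem hy, indicator_of_mem hy]
  · rw [indicator_of_notMem hy, indicator_of_notMem hy, norm_zero, zero_pow hn]

/-- **Cauchy–Schwarz on a set**: `∫_S |f| ‖V‖ ≤ √(∫_S f²) √(∫_S ‖V‖²)` for `f`, `V` square
integrable on `S`. [folklore] -/
theorem setIntegral_abs_mul_norm_le_sqrt {S : Set (EuclideanSpace ℝ (Fin 3))}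
    {f : EuclideanSpace ℝ (Fin 3) → ℝ} (hf : MemLp f 2 (volume.restrict S))
    (hV : MemLp V 2 (volume.restrict S)) :
    ∫ y in S, |f y| * ‖V y‖ ≤ Real.sqrt (∫ y in S, f y ^ 2) * Real.sqrt (∫ y in S, ‖V y‖ ^ 2) := by
  have h2 : ENNReal.ofReal 2 = 2 := by norm_num
  have hf' : MemLp (fun y => |f y|) (ENNReal.ofReal 2) (volume.restrict S) := by
    rw [h2]; exact hf.norm
  have hV' : MemLp (fun y => ‖V y‖) (ENNReal.ofReal 2) (volume.restrict S) := by
    rw [h2]; exact hV.norm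
  have key := integral_mul_le_Lp_mul_Lq_of_nonneg Real.HolderConjugate.two_two
    (Eventually.of_forall fun y => abs_nonneg (f y)) (Eventually.of_forall fun y => norm_nonneg (V y))
    hf' hV'
  refine key.trans (le_of_eq ?_)
  rw [Real.sqrt_eq_rpow, Real.sqrt_eq_rpow, one_div]
  congr 2
  · refine integral_congr_ae (Eventually.of_forall fun y => ?_)
    simp only [Real.rpow_two, sq_abs]
  · refine integral_congr_ae (Eventually.of_forall fun y => ?_)
    simp only [Real.rpow_two]

/-- From Stein's `L²` bound in `eLpNorm` form to the real form
`√(∫ |Π|²) ≤ C √(∫ ‖U‖⁴)`. [folklore] -/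
theorem sqrt_integral_sq_le_of_eLpNorm_le {Q : EuclideanSpace ℝ (Fin 3) → ℝ}
    {U : EuclideanSpace ℝ (Fin 3) → EuclideanSpace ℝ (Fin 3)} {C : ℝ≥0}
    (hQ : MemLp Q 2 volume) (hU : MemLp U 4 volume)
    (h : eLpNorm Q 2 volume ≤ C * eLpNorm U 4 volume ^ 2) :
    Real.sqrt (∫ y, Q y ^ 2) ≤ C * Real.sqrt (∫ y, ‖U y‖ ^ 4) := by
  rw [hQ.eLpNorm_eq_integral_rpow_norm (by norm_num) (by norm_num),
    hU.eLpNorm_eq_integral_rpow_norm (by norm_num) (by norm_num)] at h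
  simp only [ENNReal.toReal_ofNat, Real.norm_eq_abs] at h
  set a : ℝ := ∫ y, |Q y| ^ (2 : ℝ) with ha
  set b : ℝ := ∫ y, ‖U y‖ ^ (4 : ℝ) with hb
  have ha0 : 0 ≤ a := integral_nonneg fun y => by positivity
  have hb0 : 0 ≤ b := integral_nonneg fun y => by positivity
  have hb' : 0 ≤ b ^ (4 : ℝ)⁻¹ := by positivity
  rw [← ENNReal.ofReal_pow hb', ← ENNReal.ofReal_coe_nnreal, ← ENNReal.ofReal_mul (by positivity),
    ENNReal.ofReal_le_ofReal_iff (by positivity)] at h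
  have ha2 : Real.sqrt (∫ y, Q y ^ 2) = a ^ (2 : ℝ)⁻¹ := by
    rw [Real.sqrt_eq_rpow, ha]
    congr 1
    · refine integral_congr_ae (Eventually.of_forall fun y => ?_)
      simp only [Real.rpow_two, sq_abs]
    · norm_num
  have hb2 : Real.sqrt (∫ y, ‖U y‖ ^ 4) = (b ^ (4 : ℝ)⁻¹) ^ 2 := by
    rw [Real.sqrt_eq_rpow, hb, ← Real.rpow_natCast, ← Real.rpow_mul hb0]
    congr 1
    · refine integral_congr_ae (Eventually.of_forall fun y => ?_)
      norm_num
    · norm_num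
  rw [ha2, hb2]
  exact h

end Helpers

section Mid

variable {V : EuclideanSpace ℝ (Fin 3) → EuclideanSpace ℝ (Fin 3)}

/-- **Mid sources: Calderón–Zygmund in `L²`.**  Let `C_S` be a constant in Stein's bound
`‖Π[w]‖₂ ≤ C_S ‖w‖₄²` (`exists_eLpNorm_rieszPressure_two_le`), `S ⊆ T ⊆ B̄_R` measurable,
`‖V‖ ≤ M` a.e. on `T` and `‖V‖² ∈ L¹(T)`.  Then
`∫_S |Π[V·1_T]| ‖V‖ ≤ C_S · M · ∫_T ‖V‖²`
(Cauchy–Schwarz on `S`, Stein's bound, `‖V·1_T‖₄² ≤ M √(∫_T ‖V‖²)`).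
[cite: ChaeShvydkoy2013, §3.1 proof of Thm. 3.1 (the term q₂)] -/
theorem setIntegral_abs_rieszPressure_mul_norm_le {C_S : ℝ≥0}
    (hCS : ∀ w : EuclideanSpace ℝ (Fin 3) → EuclideanSpace ℝ (Fin 3), MemLp w 3 volume →
      MemLp w 4 volume → eLpNorm (rieszPressure w) 2 volume ≤ C_S * eLpNorm w 4 volume ^ 2)
    (hVm : AEStronglyMeasurable V volume) {S T : Set (EuclideanSpace ℝ (Fin 3))}
    (hS : MeasurableSet S) (hT : MeasurableSet T) (hST : S ⊆ T) {R : ℝ}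
    (hTR : T ⊆ closedBall (0 : EuclideanSpace ℝ (Fin 3)) R) {M : ℝ} (hM0 : 0 ≤ M)
    (hM : ∀ᵐ y ∂volume, y ∈ T → ‖V y‖ ≤ M)
    (hV2T : IntegrableOn (fun y => ‖V y‖ ^ 2) T volume) :
    ∫ y in S, |rieszPressure (T.indicator V) y| * ‖V y‖ ≤ C_S * M * ∫ y in T, ‖V y‖ ^ 2 := by
  have hμT : volume T ≠ ⊤ :=
    (lt_of_le_of_lt (measure_mono hTR) measure_closedBall_lt_top).ne
  set U := T.indicator V with hU
  have hU3 : MemLp U 3 volume := memLp_indicator_of_bound hVm hT hμT hM 3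
  have hU4 : MemLp U 4 volume := memLp_indicator_of_bound hVm hT hμT hM 4
  set Q := rieszPressure U with hQ
  have hQm : AEStronglyMeasurable Q volume := aestronglyMeasurable_rieszPressure hU3
  have hbound := hCS U hU3 hU4
  have hQ2 : MemLp Q 2 volume := by
    refine ⟨hQm, lt_of_le_of_lt hbound ?_⟩
    exact ENNReal.mul_lt_top ENNReal.coe_lt_top (ENNReal.pow_lt_top hU4.eLpNorm_lt_top)
  -- square integrability on the sets
  have hV2S : MemLp V 2 (volume.restrict S) :=
    (memLp_two_iff_integrable_sq_norm hVm.restrict).2 (hV2T.mono_set hST)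
  set eS : ℝ := ∫ y in S, ‖V y‖ ^ 2 with heS
  set eT : ℝ := ∫ y in T, ‖V y‖ ^ 2 with heT
  have heS0 : 0 ≤ eS := setIntegral_nonneg hS fun y _ => by positivity
  have heST : eS ≤ eT :=
    setIntegral_mono_set hV2T (Eventually.of_forall fun y => by positivity) hST.eventuallyLE
  -- (1) Cauchy–Schwarz on `S`
  have h1 : ∫ y in S, |Q y| * ‖V y‖ ≤ Real.sqrt (∫ y in S, Q y ^ 2) * Real.sqrt eS :=
    setIntegral_abs_mul_norm_le_sqrt (hQ2.restrict S) hV2S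
  -- (2) `∫_S Q² ≤ ∫ Q²`
  have hQsq : Integrable (fun y => Q y ^ 2) volume := (memLp_two_iff_integrable_sq hQm).1 hQ2
  have h2 : Real.sqrt (∫ y in S, Q y ^ 2) ≤ Real.sqrt (∫ y, Q y ^ 2) :=
    Real.sqrt_le_sqrt (setIntegral_le_integral hQsq (Eventually.of_forall fun y => by positivity))
  -- (3) Stein
  have h3 : Real.sqrt (∫ y, Q y ^ 2) ≤ C_S * Real.sqrt (∫ y, ‖U y‖ ^ 4) :=
    sqrt_integral_sq_le_of_eLpNorm_le hQ2 hU4 hbound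
  -- (4) `∫ ‖U‖⁴ ≤ M² ∫_T ‖V‖²`
  have h4 : ∫ y, ‖U y‖ ^ 4 ≤ M ^ 2 * eT := by
    rw [hU, integral_norm_indicator_pow hT (by norm_num), heT, ← integral_const_mul]
    have hint4 : IntegrableOn (fun y => ‖V y‖ ^ 4) T volume := by
      refine Integrable.mono' (hV2T.const_mul (M ^ 2)) ((hVm.restrict).norm.pow 4) ?_
      rw [ae_restrict_iff' hT]
      filter_upwards [hM] with y hy hyT
      have hVy := hy hyT
      rw [Real.norm_eq_abs, abs_of_nonneg (by positivity)]
      calc ‖V y‖ ^ 4 = ‖V y‖ ^ 2 * ‖V y‖ ^ 2 := by ring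
        _ ≤ M ^ 2 * ‖V y‖ ^ 2 := by
            refine mul_le_mul_of_nonneg_right ?_ (by positivity)
            exact pow_le_pow_left₀ (norm_nonneg _) hVy 2
    refine setIntegral_mono_on_ae hint4 (hV2T.const_mul _) hT ?_
    filter_upwards [hM] with y hy hyT
    have hVy := hy hyT
    calc ‖V y‖ ^ 4 = ‖V y‖ ^ 2 * ‖V y‖ ^ 2 := by ring
      _ ≤ M ^ 2 * ‖V y‖ ^ 2 := by
          refine mul_le_mul_of_nonneg_right ?_ (by positivity)
          exact pow_le_pow_left₀ (norm_nonneg _) hVy 2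
  have h4' : Real.sqrt (∫ y, ‖U y‖ ^ 4) ≤ M * Real.sqrt eT := by
    calc Real.sqrt (∫ y, ‖U y‖ ^ 4) ≤ Real.sqrt (M ^ 2 * eT) := Real.sqrt_le_sqrt h4
      _ = M * Real.sqrt eT := by rw [Real.sqrt_mul (sq_nonneg _), Real.sqrt_sq hM0]
  -- assemble
  have hsqrt : Real.sqrt eS ≤ Real.sqrt eT := Real.sqrt_le_sqrt heST
  calc ∫ y in S, |Q y| * ‖V y‖ ≤ Real.sqrt (∫ y in S, Q y ^ 2) * Real.sqrt eS := h1
    _ ≤ (C_S * (M * Real.sqrt eT)) * Real.sqrt eT := by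
        refine mul_le_mul (h2.trans (h3.trans ?_)) hsqrt (Real.sqrt_nonneg _) (by positivity)
        exact mul_le_mul_of_nonneg_left h4' (by positivity)
    _ = C_S * M * (Real.sqrt eT * Real.sqrt eT) := by ring
    _ = C_S * M * eT := by rw [Real.mul_self_sqrt (heS0.trans heST)]

end Mid

end Summit.NavierStokesRegularity.NavierStokesRegularity.Theorems.PowerGaugeEulerLiouville
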